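import Summits.Ventures.PercRepro.SixFourResidueThreeBetaLong
import Summits.Ventures.PercRepro.SixFourResidueFourBetaTail

/-!
# The `t = 3` clause of `SixFourResidue` — plane + `k` points: the `p ≥ 101` tail of the (β) certificates (p1, gen 7 — mine-2's §21.20, the twin of `betaCert4_tail`)

The one-long-line certificates `BetaCertN k p (−p·2^h) 1` of `SixFourResidueThreeBetaLong.lean` (`h = ⌊(p+1)/2⌋`) hold for every
`p ≥ 101` and `k ∈ {1, 2}` (`betaCert_tail`), so Proposition 21.5 / Theorem 21.6 at `t = 3` hold for every plane trace with
`≥ 101` points; with the tables `4 ≤ p ≤ 100` (`SixFourResidueThreeBetaTableA/B.lean`) every plane size is covered.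
The combinatorial content is the window facts of `SixFourResidueFourBetaTail.lean` (`smallTot_le_eps`, `collCount_le_smallTot`,
`eps_le_collCount_add`, `delta_add_choose_three`) plus their `c = 2` versions (`smallTot_two_le_eps`, `collCount_le_smallTot_two`);
the numerics are `two_pow_ge_pow_six` (`45000·p⁶ ≤ 2^p`) and `thirty_p_two_pow_h_le` (`30p·2^h·C(p,2) ≤ 2^p/5`) from the same file and
the coefficient bounds `20j − 36 ≤ 3·2^j` (`j ≥ 2`), `28 + 50j ≤ 39·2^j` (`j ≥ 1`):
* `k = 1`: short lines `B20 1 p m ≥ −(42 + 10p)·2^m`; `A20 1 p ≥ 6·ε(p) − 18·C(p,3)`; long lines `B20 1 p (p − j) ≥ −(3/2)·2^p − 48p`;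
* `k = 2`: short lines `B20 2 p m ≥ −(163 + 50p)·2^m`; `A20 2 p ≥ 48·ε(p) − 81·C(p,3) − 12·C(p,2)`; long lines `B20 2 p (p − j) ≥ −39·2^p − 96p`,
so `6 − 3/2 − …` resp. `48 − 39 − …` closes every condition (mine-2's (c1)–(c3), §21.20).
-/

namespace PercRepro.SixFour

/-! ## The `c = 2` window facts and the coefficient bounds -/

/-- `smallTot n p 2 ≤ ε(n)` for `n ≤ p`, `3 ≤ p`. -/
theorem smallTot_two_le_eps {n p : ℕ} (hn : n ≤ p) (hp : 3 ≤ p) : smallTot n p 2 ≤ eps n := by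
  rw [← sum_choose_filter_three_le hn hp]
  unfold smallTot
  refine Finset.sum_le_sum_of_subset (fun j hj => ?_)
  rw [Finset.mem_filter] at hj ⊢
  exact ⟨hj.1, hj.2.1⟩

/-- `collCount m ≤ smallTot m p 2` for `m ≤ p`. -/
theorem collCount_le_smallTot_two {m p : ℕ} (hm : m ≤ p) : collCount m ≤ smallTot m p 2 := by
  unfold collCount smallTot
  refine Finset.sum_le_sum_of_subset (fun j hj => ?_)
  rw [Finset.mem_filter, Finset.mem_range] at hj ⊢
  omega

/-- `smallTot n p 2 = 0` for `n ≤ 2`. -/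
theorem smallTot_two_eq_zero_of_le_two {n p : ℕ} (hn : n ≤ 2) : smallTot n p 2 = 0 := by
  unfold smallTot
  refine Finset.sum_eq_zero (fun j hj => ?_)
  rw [Finset.mem_filter] at hj
  exact Nat.choose_eq_zero_of_lt (by omega)

/-- `B20 k p m = 0` for `m ≤ 2`. -/
theorem B20_eq_zero_of_le_two {k p m : ℕ} (hm : m ≤ 2) : B20 k p m = 0 := by
  unfold B20
  rw [smallTot_eq_zero_of_le_two hm, smallTot_two_eq_zero_of_le_two hm]
  interval_cases m <;> split_ifs <;> simp [delta, eps, collCount, S3]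

/-- `20·j − 36 ≤ 3·2^j` for `j ≥ 2` (in `ℤ`; equality at `j = 3`). -/
theorem coeff_one_le {j : ℕ} (hj : 2 ≤ j) : (20 * j - 36 : ℤ) ≤ 3 * 2 ^ j := by
  rcases Nat.lt_or_ge j 3 with h | h
  · have : j = 2 := by omega
    subst this
    norm_num
  · induction j, h using Nat.le_induction with
    | base => norm_num
    | succ n hn ih =>
      have h8 : (8 : ℤ) ≤ 2 ^ n := by
        calc (8 : ℤ) = 2 ^ 3 := by norm_num
          _ ≤ 2 ^ n := pow_le_pow_right₀ (by norm_num) hn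
      have ih' := ih (by omega)
      push_cast
      rw [pow_succ]
      nlinarith [ih', h8]

/-- `28 + 50·j ≤ 39·2^j` for `j ≥ 1` (in `ℤ`; equality at `j = 1`). -/
theorem coeff_two_le {j : ℕ} (hj : 1 ≤ j) : (28 + 50 * j : ℤ) ≤ 39 * 2 ^ j := by
  induction j, hj using Nat.le_induction with
  | base => norm_num
  | succ n hn ih =>
    have h2 : (2 : ℤ) ≤ 2 ^ n := by
      calc (2 : ℤ) = 2 ^ 1 := by norm_num
        _ ≤ 2 ^ n := pow_le_pow_right₀ (by norm_num) hn
    push_cast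
    rw [pow_succ]
    nlinarith [ih, h2]

/-! ## The tail certificates -/

/-- The shared arithmetic facts at `p ≥ 101`: `ε(p) = 2^p − (1 + p + C(p,2))` in `ℤ`, the polynomial terms against `2^p`,
and `150·p·2^h·C(p,2) ≤ 2^p`. -/
theorem tail_facts {p : ℕ} (hp : 101 ≤ p) :
    ((eps p : ℤ) = 2 ^ p - (1 + p + (p.choose 2 : ℤ))) ∧
    (100 * (48 * (1 + p + (p.choose 2 : ℤ)) + 81 * (p.choose 3 : ℤ) + 12 * (p.choose 2 : ℤ) + 144 * p) ≤ 2 ^ p) ∧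
    (150 * (p : ℤ) * 2 ^ ((p + 1) / 2) * (p.choose 2 : ℤ) ≤ 2 ^ p) := by
  refine ⟨?_, ?_, ?_⟩
  · unfold eps
    have := S3_le_two_pow' p
    have h' : 1 + p + p.choose 2 ≤ 2 ^ p := by omega
    rw [Nat.cast_sub h']
    push_cast
    ring
  · have hC2 : (p.choose 2 : ℤ) ≤ (p : ℤ) ^ 2 := by exact_mod_cast Nat.choose_le_pow p 2
    have hC3 : (p.choose 3 : ℤ) ≤ (p : ℤ) ^ 3 := by exact_mod_cast Nat.choose_le_pow p 3
    have h6 : 45000 * (p : ℤ) ^ 6 ≤ 2 ^ p := by exact_mod_cast two_pow_ge_pow_six hp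
    have hp101 : (101 : ℤ) ≤ p := by exact_mod_cast hp
    nlinarith [hC2, hC3, h6, hp101, pow_pos (show (0 : ℤ) < p by omega) 3]
  · have := thirty_p_two_pow_h_le hp
    have h' : (150 : ℚ) * p * 2 ^ ((p + 1) / 2) * (p.choose 2 : ℚ) ≤ 2 ^ p := by linarith
    exact_mod_cast h'

/-- **The `p ≥ 101` certificate at `k = 1`**: `BetaCertN 1 p (−p·2^h) 1`. -/
theorem betaCert_tail_one {p : ℕ} (hp : 101 ≤ p) : BetaCertN 1 p (-(p : ℤ) * 2 ^ ((p + 1) / 2)) 1 := by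
  set h := (p + 1) / 2 with hh
  obtain ⟨he, hpoly, hkey⟩ := tail_facts hp
  rw [← hh] at hkey
  have hp0 : (0 : ℤ) ≤ p := by positivity
  have h2h : (0 : ℤ) ≤ 2 ^ h := by positivity
  have hp101 : (101 : ℤ) ≤ p := by exact_mod_cast hp
  -- `A20 1 p ≥ 6·ε(p) − 18·C(p,3)`
  have hA : 6 * (eps p : ℤ) - 18 * (p.choose 3 : ℤ) ≤ A20 1 p := by
    unfold A20
    rw [if_pos rfl]
    have hs : (smallTot p p 3 : ℤ) ≤ eps p := by exact_mod_cast smallTot_le_eps (le_refl p) (by omega)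
    have hd : (delta p : ℤ) + (p.choose 3 : ℤ) = eps p := by exact_mod_cast delta_add_choose_three p
    linarith
  refine ⟨by norm_num, by nlinarith, ?_, ?_, ?_⟩
  · -- (c1) the short lines
    intro m hm hm2
    rw [Nat.cast_one, one_mul]
    rcases Nat.lt_or_ge m 3 with hm3 | hm3
    · rw [B20_eq_zero_of_le_two (by omega)]
      have h0 : (0 : ℤ) ≤ (p : ℤ) * 2 ^ h * (m.choose 2 : ℤ) := by positivity
      have e : 20 * (-(p : ℤ) * 2 ^ h) * (m.choose 2 : ℤ) = -20 * ((p : ℤ) * 2 ^ h * (m.choose 2 : ℤ)) := by ring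
      rw [e]
      linarith
    · have hB : -(42 + 10 * (p : ℤ)) * 2 ^ m ≤ B20 1 p m := by
        unfold B20
        rw [if_pos rfl]
        have e1 : (m.choose 3 : ℤ) ≤ 2 ^ m := by
          have := delta_add_choose_three m
          have := eps_le_two_pow' m
          exact_mod_cast (by omega : m.choose 3 ≤ 2 ^ m)
        have e2 : (delta m : ℤ) ≤ 2 ^ m := by
          have := delta_add_choose_three m
          have := eps_le_two_pow' m
          exact_mod_cast (by omega : delta m ≤ 2 ^ m)
        have e3 : (eps m : ℤ) ≤ 2 ^ m := by exact_mod_cast eps_le_two_pow' m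
        have e4 : ((p - m : ℕ) : ℤ) ≤ p := by exact_mod_cast Nat.sub_le p m
        have e5 : (0 : ℤ) ≤ (smallTot m p 3 : ℤ) + (collCount m : ℤ) := by positivity
        have e6 : (0 : ℤ) ≤ (eps m : ℤ) := by positivity
        have e7 : (0 : ℤ) ≤ ((p - m : ℕ) : ℤ) := by positivity
        nlinarith [mul_le_mul e3 e4 e7 (by positivity : (0 : ℤ) ≤ 2 ^ m)]
      have h2m : (2 : ℤ) ^ m ≤ 2 ^ h := pow_le_pow_right₀ (by norm_num) (by omega)
      have hC : (3 : ℤ) ≤ (m.choose 2 : ℤ) := by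
        have := Nat.choose_le_choose 2 hm3
        exact_mod_cast (by simpa using this : 3 ≤ m.choose 2)
      have h2m0 : (0 : ℤ) ≤ 2 ^ m := by positivity
      have s1 : (42 + 10 * (p : ℤ)) * 2 ^ m ≤ 20 * p * (m.choose 2 : ℤ) * 2 ^ m := by
        have : (42 + 10 * (p : ℤ)) ≤ 20 * p * (m.choose 2 : ℤ) := by nlinarith
        exact mul_le_mul_of_nonneg_right this h2m0
      have s2 : 20 * (p : ℤ) * (m.choose 2 : ℤ) * 2 ^ m ≤ 20 * p * (m.choose 2 : ℤ) * 2 ^ h :=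
        mul_le_mul_of_nonneg_left h2m (by positivity)
      nlinarith [hB, s1, s2]
  · -- (c2) no long line
    rw [Nat.cast_one, one_mul]
    have e : 20 * (-(p : ℤ) * 2 ^ h) * (p.choose 2 : ℤ) = -20 * ((p : ℤ) * 2 ^ h * (p.choose 2 : ℤ)) := by ring
    rw [e]
    linarith [hA, hkey, hpoly, he]
  · -- (c3) one long line `m₁ = p − j`
    intro m₁ hm₁ hlong
    rw [Nat.cast_one, one_mul]
    have hm3 : 3 ≤ m₁ := by omega
    obtain ⟨j, hj⟩ : ∃ j, p - m₁ = j := ⟨_, rfl⟩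
    have hj1 : 1 ≤ j := by omega
    have hpj : p = j + m₁ := by omega
    have hB : -3 * (2 : ℤ) ^ p - 96 * p ≤ 2 * B20 1 p m₁ := by
      unfold B20
      rw [if_pos rfl, hj]
      have e1 : (collCount m₁ : ℤ) ≤ smallTot m₁ p 3 := by exact_mod_cast collCount_le_smallTot hm₁
      have e2 : (eps m₁ : ℤ) ≤ (collCount m₁ : ℤ) + (m₁ + 1) := by exact_mod_cast eps_le_collCount_add hm3
      have e3 : (delta m₁ : ℤ) + (m₁.choose 3 : ℤ) = eps m₁ := by exact_mod_cast delta_add_choose_three m₁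
      have e4 : (eps m₁ : ℤ) ≤ 2 ^ m₁ := by exact_mod_cast eps_le_two_pow' m₁
      have e5 : (0 : ℤ) ≤ (m₁.choose 3 : ℤ) := by positivity
      have e6 : (0 : ℤ) ≤ (eps m₁ : ℤ) := by positivity
      have h2 : (2 : ℤ) ^ p = 2 ^ j * 2 ^ m₁ := by rw [hpj, pow_add]
      have h2m : (0 : ℤ) ≤ 2 ^ m₁ := by positivity
      have h2p : (0 : ℤ) ≤ 2 ^ p := by positivity
      have hm1p : (m₁ : ℤ) + 1 ≤ p := by exact_mod_cast hm₁
      -- `2·B20 ≥ 36·C + 2(18 − 10j)·ε − 96(m₁+1)`; for `j = 1` the `ε`-coefficient is `+16 ≥ 0`, for `j ≥ 2` use `20j − 36 ≤ 3·2^j`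
      rcases Nat.lt_or_ge j 2 with hj2 | hj2
      · have hj' : j = 1 := by omega
        subst hj'
        push_cast
        nlinarith [e1, e2, e3, e5, e6, hm1p, h2p]
      · have hcoef : (20 * (j : ℤ) - 36) * 2 ^ m₁ ≤ 3 * 2 ^ p := by
          have h1 := coeff_one_le hj2
          rw [h2]
          nlinarith [mul_le_mul_of_nonneg_right h1 h2m]
        have hj0 : (2 : ℤ) ≤ j := by exact_mod_cast hj2
        have hneg : (0 : ℤ) ≤ 20 * (j : ℤ) - 36 := by linarith
        have hprod := mul_le_mul_of_nonneg_left e4 hneg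
        linarith [hprod, hcoef, e1, e2, e3, e5, e6, hm1p]
    -- the linear closing step in `X = p·2^h·C(p,2)`, `Y = p·2^h·C(m₁,2)`
    have hY0 : (0 : ℤ) ≤ (p : ℤ) * 2 ^ h * (m₁.choose 2 : ℤ) := by positivity
    have e : 20 * (-(p : ℤ) * 2 ^ h) * ((p.choose 2 : ℤ) - (m₁.choose 2 : ℤ)) =
        -20 * ((p : ℤ) * 2 ^ h * (p.choose 2 : ℤ)) + 20 * ((p : ℤ) * 2 ^ h * (m₁.choose 2 : ℤ)) := by ring
    rw [e]
    linarith [hA, hB, he, hpoly, hkey, hY0]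

/-- **The `p ≥ 101` certificate at `k = 2`**: `BetaCertN 2 p (−p·2^h) 1`. -/
theorem betaCert_tail_two {p : ℕ} (hp : 101 ≤ p) : BetaCertN 2 p (-(p : ℤ) * 2 ^ ((p + 1) / 2)) 1 := by
  set h := (p + 1) / 2 with hh
  obtain ⟨he, hpoly, hkey⟩ := tail_facts hp
  rw [← hh] at hkey
  have hp0 : (0 : ℤ) ≤ p := by positivity
  have h2h : (0 : ℤ) ≤ 2 ^ h := by positivity
  have hp101 : (101 : ℤ) ≤ p := by exact_mod_cast hp
  have hk2 : ((2 : ℕ) = 1) ↔ False := by decide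
  -- `A20 2 p ≥ 48·ε(p) − 81·C(p,3) − 12·C(p,2)`
  have hA : 48 * (eps p : ℤ) - 81 * (p.choose 3 : ℤ) - 12 * (p.choose 2 : ℤ) ≤ A20 2 p := by
    unfold A20
    simp only [hk2, if_false]
    have hs : (smallTot p p 3 : ℤ) ≤ eps p := by exact_mod_cast smallTot_le_eps (le_refl p) (by omega)
    have hs2 : (smallTot p p 2 : ℤ) ≤ eps p := by exact_mod_cast smallTot_two_le_eps (le_refl p) (by omega)
    have hd : (delta p : ℤ) + (p.choose 3 : ℤ) = eps p := by exact_mod_cast delta_add_choose_three p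
    linarith
  refine ⟨by norm_num, by nlinarith, ?_, ?_, ?_⟩
  · -- (c1) the short lines
    intro m hm hm2
    rw [Nat.cast_one, one_mul]
    rcases Nat.lt_or_ge m 3 with hm3 | hm3
    · rw [B20_eq_zero_of_le_two (by omega)]
      have h0 : (0 : ℤ) ≤ (p : ℤ) * 2 ^ h * (m.choose 2 : ℤ) := by positivity
      have e : 20 * (-(p : ℤ) * 2 ^ h) * (m.choose 2 : ℤ) = -20 * ((p : ℤ) * 2 ^ h * (m.choose 2 : ℤ)) := by ring
      rw [e]
      linarith
    · have hB : -(163 + 50 * (p : ℤ)) * 2 ^ m ≤ B20 2 p m := by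
        unfold B20
        simp only [hk2, if_false]
        have e1 : (m.choose 3 : ℤ) ≤ 2 ^ m := by
          have := delta_add_choose_three m
          have := eps_le_two_pow' m
          exact_mod_cast (by omega : m.choose 3 ≤ 2 ^ m)
        have e2 : (delta m : ℤ) ≤ 2 ^ m := by
          have := delta_add_choose_three m
          have := eps_le_two_pow' m
          exact_mod_cast (by omega : delta m ≤ 2 ^ m)
        have e3 : (eps m : ℤ) ≤ 2 ^ m := by exact_mod_cast eps_le_two_pow' m
        have e4 : ((p - m : ℕ) : ℤ) ≤ p := by exact_mod_cast Nat.sub_le p m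
        have e5 : (0 : ℤ) ≤ (smallTot m p 3 : ℤ) + (collCount m : ℤ) := by positivity
        have e5' : (0 : ℤ) ≤ (smallTot m p 2 : ℤ) := by positivity
        have e6 : (0 : ℤ) ≤ (eps m : ℤ) := by positivity
        have e7 : (0 : ℤ) ≤ ((p - m : ℕ) : ℤ) := by positivity
        nlinarith [mul_le_mul e3 e4 e7 (by positivity : (0 : ℤ) ≤ 2 ^ m)]
      have h2m : (2 : ℤ) ^ m ≤ 2 ^ h := pow_le_pow_right₀ (by norm_num) (by omega)
      have hC : (3 : ℤ) ≤ (m.choose 2 : ℤ) := by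
        have := Nat.choose_le_choose 2 hm3
        exact_mod_cast (by simpa using this : 3 ≤ m.choose 2)
      have h2m0 : (0 : ℤ) ≤ 2 ^ m := by positivity
      have s1 : (163 + 50 * (p : ℤ)) * 2 ^ m ≤ 20 * p * (m.choose 2 : ℤ) * 2 ^ m := by
        have : (163 + 50 * (p : ℤ)) ≤ 20 * p * (m.choose 2 : ℤ) := by nlinarith
        exact mul_le_mul_of_nonneg_right this h2m0
      have s2 : 20 * (p : ℤ) * (m.choose 2 : ℤ) * 2 ^ m ≤ 20 * p * (m.choose 2 : ℤ) * 2 ^ h :=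
        mul_le_mul_of_nonneg_left h2m (by positivity)
      nlinarith [hB, s1, s2]
  · -- (c2) no long line
    rw [Nat.cast_one, one_mul]
    have e : 20 * (-(p : ℤ) * 2 ^ h) * (p.choose 2 : ℤ) = -20 * ((p : ℤ) * 2 ^ h * (p.choose 2 : ℤ)) := by ring
    rw [e]
    linarith [hA, hkey, hpoly, he]
  · -- (c3) one long line `m₁ = p − j`
    intro m₁ hm₁ hlong
    rw [Nat.cast_one, one_mul]
    have hm3 : 3 ≤ m₁ := by omega
    obtain ⟨j, hj⟩ : ∃ j, p - m₁ = j := ⟨_, rfl⟩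
    have hj1 : 1 ≤ j := by omega
    have hpj : p = j + m₁ := by omega
    have hB : -39 * (2 : ℤ) ^ p - 96 * p ≤ B20 2 p m₁ := by
      unfold B20
      simp only [hk2, if_false]
      rw [hj]
      have e1 : (collCount m₁ : ℤ) ≤ smallTot m₁ p 3 := by exact_mod_cast collCount_le_smallTot hm₁
      have e1' : (collCount m₁ : ℤ) ≤ smallTot m₁ p 2 := by exact_mod_cast collCount_le_smallTot_two hm₁.le
      have e2 : (eps m₁ : ℤ) ≤ (collCount m₁ : ℤ) + (m₁ + 1) := by exact_mod_cast eps_le_collCount_add hm3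
      have e3 : (delta m₁ : ℤ) + (m₁.choose 3 : ℤ) = eps m₁ := by exact_mod_cast delta_add_choose_three m₁
      have e4 : (eps m₁ : ℤ) ≤ 2 ^ m₁ := by exact_mod_cast eps_le_two_pow' m₁
      have e5 : (0 : ℤ) ≤ (m₁.choose 3 : ℤ) := by positivity
      have e6 : (0 : ℤ) ≤ (eps m₁ : ℤ) := by positivity
      have h2 : (2 : ℤ) ^ p = 2 ^ j * 2 ^ m₁ := by rw [hpj, pow_add]
      have h2m : (0 : ℤ) ≤ 2 ^ m₁ := by positivity
      have hm1p : (m₁ : ℤ) + 1 ≤ p := by exact_mod_cast hm₁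
      have hcoef : (28 + 50 * (j : ℤ)) * 2 ^ m₁ ≤ 39 * 2 ^ p := by
        have h1 := coeff_two_le hj1
        rw [h2]
        nlinarith [mul_le_mul_of_nonneg_right h1 h2m]
      have hj0 : (1 : ℤ) ≤ j := by exact_mod_cast hj1
      have hneg : (0 : ℤ) ≤ 28 + 50 * (j : ℤ) := by linarith
      have hprod := mul_le_mul_of_nonneg_left e4 hneg
      -- `B20 ≥ 81·C(m₁,3) − (28 + 50j)·ε(m₁) − 96(m₁+1)`
      linarith [hprod, hcoef, e1, e1', e2, e3, e5, e6, hm1p]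
    have hY0 : (0 : ℤ) ≤ (p : ℤ) * 2 ^ h * (m₁.choose 2 : ℤ) := by positivity
    have e : 20 * (-(p : ℤ) * 2 ^ h) * ((p.choose 2 : ℤ) - (m₁.choose 2 : ℤ)) =
        -20 * ((p : ℤ) * 2 ^ h * (p.choose 2 : ℤ)) + 20 * ((p : ℤ) * 2 ^ h * (m₁.choose 2 : ℤ)) := by ring
    rw [e]
    linarith [hA, hB, he, hpoly, hkey, hY0]

/-- **Theorem 21.20 (mine-2)**: the `p ≥ 101` certificate `BetaCertN k p (−p·2^h) 1` for `k ∈ {1, 2}`. -/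
theorem betaCert_tail {k p : ℕ} (hk : k = 1 ∨ k = 2) (hp : 101 ≤ p) :
    BetaCertN k p (-(p : ℤ) * 2 ^ ((p + 1) / 2)) 1 := by
  rcases hk with rfl | rfl
  · exact betaCert_tail_one hp
  · exact betaCert_tail_two hp

open Finset ThmH

variable {α : Type*} [DecidableEq α] {M : Matroid α} [M.Finite] {G : Finset α}

/-- **Proposition 21.5 at `t = 3` for every plane trace with `≥ 101` points**. -/
theorem J_three_nonneg_of_plane_add_one_of_tail (hs : Simple M) (hG : G ⊆ gr M) {P₀ : Finset α} (hP₀ : P₀ ∈ planes M)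
    (hcard : (P₀ ∩ G).card + 1 = G.card) (hp : 101 ≤ (P₀ ∩ G).card) : 0 ≤ J M G 3 :=
  J_three_nonneg_of_plane_add_one_of_cert hs hG hP₀ hcard (betaCert_tail (Or.inl rfl) hp)

/-- **Theorem 21.6 at `t = 3` for every plane trace with `≥ 101` points**. -/
theorem J_three_nonneg_of_plane_add_two_of_tail (hs : Simple M) (hG : G ⊆ gr M) (hr : M.eRk (G : Set α) = 4)
    {P₀ : Finset α} (hP₀ : P₀ ∈ planes M) (hcard : (P₀ ∩ G).card + 2 = G.card) (hp : 101 ≤ (P₀ ∩ G).card) :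
    0 ≤ J M G 3 :=
  J_three_nonneg_of_plane_add_two_of_cert hs hG hP₀ hr hcard (betaCert_tail (Or.inr rfl) hp)

end PercRepro.SixFour
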